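import Literature.NumberTheory.LFunctions.WeilWindowForm
import Literature.NumberTheory.LFunctions.YoshidaWindowSpaces
import HarnessLib

/-!
# Format C (Fourier–Galerkin certificates of Weil positivity): definitions — window functions and
  the sesquilinear window form

Definitions file of the format-C helper files `Summits/RiemannHypothesis/RiemannHypothesis/Theorems/
WeilFormatCWindow*.lean` (`--supports stmt-RiemannHypothesis-0098`, lead-track anchor), RH-free. Seat
rh-explicit-weil-3 (gen3). Normalisation of `Literature/NumberTheory/LFunctions/WeilWindowForm.lean`
(`weilWindowForm a u = P(u) + 𝓔_a(u) − M_a‖u‖₂²`).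

* `IsWindowFunction a u` — the analytic envelope of Yoshida's `K(a)` used by every format-C lemma:
  `u` measurable, `u = 0` off `[-a, a]`, bounded, and Lipschitz ON the closed window (jumps at `±a`
  allowed). Trigonometric windows `Σ c_n χ_n`, truncated Fourier series and smooth `2a`-periodic
  functions cut off at the window are window functions.
* the **sesquilinear window form** `weilWindowSesq a u v` (linear in `u`, conjugate-linear in `v`):
  the polarisation of `weilWindowForm a`, piece by piece —
  pole part `weilPoleSesq u v = 2(∫u·cosh(x/2))(conj ∫v·cosh(x/2)) − 2(∫u·sinh(x/2))(conj ∫v·sinh(x/2))`,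
  increments `weilIncrementSesq u v t = ∫ (u(x+t) − u(x)) conj(v(x+t) − v(x)) dx`, the same prime /
  archimedean weights as `weilDirichletEnergy a`, and `−M_a ∫ u conj v`. Its diagonal is the window
  form (`weilWindowSesq a u u = weilWindowForm a u`, proved in `WeilFormatCWindowSesq.lean`), and its
  matrix on Yoshida's basis `χ_n` is the Gram matrix `G(m,n)` a format-C certificate computes
  (Yoshida 1992 (5.13)–(5.16)); the expansion
  `weilWindowForm a (Σ c_n χ_n) = Re Σ_{m,n} c_m conj(c_n) weilWindowSesq a χ_m χ_n` is
  `WeilFormatCWindowGram.lean`.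

* the real **sector bases** `chiEven a i` (`χ_0`, `(χ_i + χ_{−i})/√2`) and `chiOdd a i`
  (`(χ_i − χ_{−i})/√2`) of FORMATC-DESIGN §1 (c1), on which the per-parity certificates' Gram matrices
  `weilWindowSesq a (chiEven a i) (chiEven a j)` / `… chiOdd …` are indexed by `i, j ∈ ℕ`
  (bridge to the dictionary: `WeilFormatCSectorBasis.lean`).

Only definitions and their unfolding lemmas live here (tree rule: definitions are not buried in
proof files).
-/

set_option autoImplicit false
set_option linter.dupNamespace false  -- the mandated namespace repeats `RiemannHypothesis`

noncomputable section

open Complex Filter Set MeasureTheory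
open scoped Real Topology ComplexConjugate ArithmeticFunction.vonMangoldt

namespace Summit.RiemannHypothesis.RiemannHypothesis.Theorems.WeilFormatC

open Literature.NumberTheory.LFunctions

/-- A **window function** on `[-a, a]`: measurable, vanishing off the closed window, bounded, and
Lipschitz on the closed window (so it may jump at `±a`, like Yoshida's `K(a)` functions and the
trigonometric windows `Σ c_n χ_n`). These are exactly the hypotheses under which the format-C files
manipulate the window form (`WeilFormatCWindowFamily/Limit/Parity/Sectors.lean`). -/
def IsWindowFunction (a : ℝ) (u : ℝ → ℂ) : Prop :=
  Measurable u ∧ (∀ x, x ∉ Icc (-a) a → u x = 0) ∧ (∃ S : ℝ, ∀ x, ‖u x‖ ≤ S) ∧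
    ∃ L : ℝ, ∀ x y, x ∈ Icc (-a) a → y ∈ Icc (-a) a → ‖u y - u x‖ ≤ L * |y - x|

namespace IsWindowFunction

variable {a : ℝ} {u : ℝ → ℂ}

/-- A window function is measurable. -/
theorem measurable (h : IsWindowFunction a u) : Measurable u := h.1

/-- A window function vanishes off the closed window. -/
theorem eq_zero (h : IsWindowFunction a u) : ∀ x, x ∉ Icc (-a) a → u x = 0 := h.2.1

/-- A window function is bounded. -/
theorem bounded (h : IsWindowFunction a u) : ∃ S : ℝ, ∀ x, ‖u x‖ ≤ S := h.2.2.1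

/-- A window function is Lipschitz on the closed window. -/
theorem lipschitz (h : IsWindowFunction a u) :
    ∃ L : ℝ, ∀ x y, x ∈ Icc (-a) a → y ∈ Icc (-a) a → ‖u y - u x‖ ≤ L * |y - x| := h.2.2.2

end IsWindowFunction

/-- The **sesquilinear increment**: `D_t(u, v) = ∫ (u(x+t) − u(x)) · conj (v(x+t) − v(x)) dx`
(polarisation of `weilIncrement`: `D_t(u, u) = D_t(u)`). -/
def weilIncrementSesq (u v : ℝ → ℂ) (t : ℝ) : ℂ :=
  ∫ x : ℝ, (u (x + t) - u x) * conj (v (x + t) - v x)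

/-- The **sesquilinear pole form**:
`P(u, v) = 2 (∫ u cosh(x/2)) conj(∫ v cosh(x/2)) − 2 (∫ u sinh(x/2)) conj(∫ v sinh(x/2))`
(polarisation of `weilPoleForm`). -/
def weilPoleSesq (u v : ℝ → ℂ) : ℂ :=
  2 * (∫ x : ℝ, u x * (Real.cosh (x / 2) : ℂ)) * conj (∫ x : ℝ, v x * (Real.cosh (x / 2) : ℂ)) -
    2 * (∫ x : ℝ, u x * (Real.sinh (x / 2) : ℂ)) * conj (∫ x : ℝ, v x * (Real.sinh (x / 2) : ℂ))

/-- The **sesquilinear Dirichlet energy** of the window `[-a, a]`: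
`𝓔_a(u, v) = Σ_{log n < 2a} Λ(n) n^{-1/2} D_{log n}(u, v) + ∫₀^∞ e^{t/2}/(2 sinh t) D_t(u, v) dt`
(polarisation of `weilDirichletEnergy a`). -/
def weilDirichletSesq (a : ℝ) (u v : ℝ → ℂ) : ℂ :=
  (∑ n ∈ weilPrimeIndex a, ((Λ n : ℝ) / Real.sqrt n : ℂ) * weilIncrementSesq u v (Real.log n)) +
    ∫ t in Ioi (0 : ℝ), (weilArchDensity t : ℂ) * weilIncrementSesq u v t

/-- The **sesquilinear window form** `W_a(u, v) = P(u, v) + 𝓔_a(u, v) − M_a ∫ u conj v`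
(polarisation of `weilWindowForm a`; linear in `u`, conjugate-linear in `v`). On Yoshida's basis
`χ_n` of `K(a)` its matrix `W_a(χ_m, χ_n)` is the Gram matrix of a Fourier–Galerkin (format-C)
certificate (Yoshida 1992 (5.13)–(5.16)). -/
def weilWindowSesq (a : ℝ) (u v : ℝ → ℂ) : ℂ :=
  weilPoleSesq u v + weilDirichletSesq a u v -
    (weilMarkovConstant a : ℂ) * ∫ x : ℝ, u x * conj (v x)

/-- Unfolding lemma for `weilWindowSesq`. -/
theorem weilWindowSesq_eq (a : ℝ) (u v : ℝ → ℂ) :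
    weilWindowSesq a u v = weilPoleSesq u v +
      ((∑ n ∈ weilPrimeIndex a, ((Λ n : ℝ) / Real.sqrt n : ℂ) * weilIncrementSesq u v (Real.log n)) +
        ∫ t in Ioi (0 : ℝ), (weilArchDensity t : ℂ) * weilIncrementSesq u v t) -
      (weilMarkovConstant a : ℂ) * ∫ x : ℝ, u x * conj (v x) := rfl

/-! ## The real sector bases of the trigonometric windows (FORMATC-DESIGN §1 (c1)) -/

/-- The **even sector basis** of the trigonometric windows: `w⁺_0 = χ_0`,
`w⁺_i = (χ_i + χ_{−i})/√2` (`i ≥ 1`) — i.e. `(2a)^{-1/2}·√2 cos(πix/a)` on `[-a, a]`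
(weil-10 FORMATC-DESIGN §1 (c1); Yoshida 1992 (6.10), the sector Grams). An even coefficient vector
`c` (`c_{−n} = c_n`) gives `Σ_{|n| ≤ N} c_n χ_n = c_0 w⁺_0 + Σ_{1 ≤ i ≤ N} √2 c_i w⁺_i`
(`WeilFormatCSectorBasis.lean`). -/
def chiEven (a : ℝ) (i : ℕ) : ℝ → ℂ :=
  if i = 0 then Yoshida1992.chi a 0
  else ((1 / Real.sqrt 2 : ℝ) : ℂ) •
    (Yoshida1992.chi a (i : ℤ) +
      Yoshida1992.chi a (-(i : ℤ)))

/-- The **odd sector basis** of the trigonometric windows: `w⁻_i = (χ_i − χ_{−i})/√2` (`i ≥ 1`;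
`w⁻_0 = 0`) — i.e. `(2a)^{-1/2}·√2 i sin(πix/a)` on `[-a, a]` (FORMATC-DESIGN §1 (c1)). An odd
coefficient vector (`c_{−n} = −c_n`) gives `Σ_{|n| ≤ N} c_n χ_n = Σ_{1 ≤ i ≤ N} √2 c_i w⁻_i`. -/
def chiOdd (a : ℝ) (i : ℕ) : ℝ → ℂ :=
  ((1 / Real.sqrt 2 : ℝ) : ℂ) •
    (Yoshida1992.chi a (i : ℤ) -
      Yoshida1992.chi a (-(i : ℤ)))

end Summit.RiemannHypothesis.RiemannHypothesis.Theorems.WeilFormatC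

end
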